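import Literature.NumberTheory.EllipticCurves.SelmerPInftyModelAction
import Literature.NumberTheory.EllipticCurves.SelmerImage
import Literature.NumberTheory.EllipticCurves.PeriodIndexCorestriction
import Literature.NumberTheory.EllipticCurves.SelmerRestrictionCorank
import HarnessLib

/-!
# Restriction `Sel^(n)(E/K) → Sel^(n)(E_L/L)` at finite level; over a quadratic field,
# `Sel_p(E/ℚ) ↪ Sel_p(E/K)^{Gal(K/ℚ)}` for odd `p`

The finite-level (`E[n]`-coefficients) companion of `SelmerPInftyRestriction` /
`SelmerPInftyModelAction` (which treat `E[p^∞]`). For a Weierstrass curve `W` (an elliptic curve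
`E`) over a field `K`, a `K`-field `L` and `n : ℤ`, on the tree's model of Galois cohomology
(`WeierstrassCurve.galH1Torsion`, `WeierstrassCurve.selmerGroup` of file `Selmer`):

* `torsionBaseChangeMap W L n : E[n](K̄) → E_L[n](L̄)` — the chosen-embedding map on points
  (`pointsMap`) followed by the identification of coefficient modules
  (`localPointsEquivGeomPoints`), on `n`-torsion; equivariant along `resGal L : Γ_L → Γ_K`;
* `resTorsion W L n : H¹(K, E[n]) → H¹(L, E_L[n])` — restriction; it commutes with
  `H¹(·, E[n]) → H¹(·, E)` (`torsionH1ToH1_resTorsion`) and therefore **maps `Sel^(n)(E/K)` into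
  `Sel^(n)(E_L/L)`** (`resTorsion_mem_selmerGroup`: the Selmer groups are the preimages of `Ш`,
  `selmerGroup_eq_comap_sha`, and restriction maps `Ш(E/K)` into `Ш(E_L/L)`,
  `resBaseChange_mem_sha`) — Dokchitser–Dokchitser, Ann. of Math. 172 (2010), proof of
  Lemma 4.14: *"the restriction map from `H¹(K, E[pⁿ])` to `H¹(F, E[pⁿ])^G` induces a map
  `Sel_{pⁿ}(E/K) → Sel_{pⁿ}(E/F)^G` whose kernel and cokernel are killed by `|G|²`"*;
* for `L/K` algebraic, the **subgroup model** `modelIsoTorsion W L n :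
  H¹(L, E_L[n]) ≃ H¹(galRange L, E[n])` identifying `resTorsion` with the plain restriction to
  the subgroup `galRange L ≤ Γ_K` (`modelIsoTorsion_resTorsion`); hence, for number fields, the
  kernel of `resTorsion` is killed by the index `(Γ_K : galRange L)`
  (`index_nsmul_eq_zero_of_resTorsion_eq_zero`, from `cor ∘ res = index`, Serre, *Galois
  Cohomology*, I.§2.4, Prop. 9, the tree's `index_nsmul_eq_zero_of_resSubgroupH1_eq_zero`);
* for `E = W/ℚ` and a Galois quadratic number field `K` with non-trivial automorphism `σ₀`:
  the action `conjAct W σ₀ n` of `σ₀` on `H¹(K, E[n])` (file `SelmerGaloisAction`) is, in the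
  subgroup model, the conjugation action of the transported lift `liftToAbsGal K σ₀ ∈ Γ_ℚ`
  (`modelIsoTorsion_conjAct`), so **restricted classes are fixed by `Gal(K/ℚ)`**
  (`conjAct_resTorsion`), and the kernel of `resTorsion` is killed by `2`
  (`two_nsmul_eq_zero_of_resTorsion_eq_zero`);
* consequently, for an ODD prime `p`, **`res : H¹(ℚ, E[p]) → H¹(K, E[p])` is injective**
  (`resTorsion_injective_of_odd`: `H¹(ℚ, E[p])` is killed by `p`, `zsmul_discreteH1_torsion`, and
  by `2` on the kernel) and carries `Sel_p(E/ℚ)` into the `+1`-eigenspace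
  `Sel_p(E/K)^+ = {s ∈ Sel_p(E/K) : σ₀ s = s}` (`resTorsion_mem_selmerGroup_and_conjAct_eq`), so
  `#Sel_p(E/ℚ) ≤ #Sel_p(E/K)^+` whenever the latter is finite
  (`natCard_selmerGroup_le_of_forall_mem`) — the inclusion `Sel(E/ℚ)_p ↪ Sel(E/K)_p^+` of
  Gross 1991, §5 (5.1) / Kolyvagin 1990, used by the BSD route `KolyvaginDepthDoor` to read
  Kolyvagin's eigen-Selmer bound over `ℚ` (no point on the quadratic twist needed).

Everything here is proved; no named fact is introduced. The number field `K` over `ℚ` is taken in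
`Type` (the tree's universe discipline for compatible pairs, as in `SelmerPInftyModelAction`).

## References

* T. Dokchitser, V. Dokchitser, *On the Birch–Swinnerton-Dyer quotients modulo squares*, Ann. of
  Math. 172 (2010), Lemma 4.14 (proof). [DokchitserDokchitserAnnals2010]
* J.-P. Serre, *Galois Cohomology* (1997), I.§2.4 (res, cor; Prop. 9), II.§1.1.
  [SerreGaloisCohomology1997]
* B. H. Gross, *Kolyvagin's work on modular elliptic curves*, LMS LNS 153 (1991), §5 (5.1).
  [GrossLMS1991]
-/

noncomputable section

open scoped Classical

universe u

namespace Literature.NumberTheory.EllipticCurves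

open GaloisRepresentations WeierstrassCurve

/-! ## `E[n](K̄) → E_L[n](L̄)` and restriction on `H¹(·, E[n])` -/

section TorsionPoints

variable {K : Type u} [Field K] (W : WeierstrassCurve K) (L : Type u) [Field L] [Algebra K L]
  (n : ℤ)

/-- The map `E[n](K̄) → E_L[n](L̄)`: the points map `E(K̄) → E(L̄)` along the chosen embedding
`K̄ → L̄` (`pointsMap`) followed by the identification `E(L̄) = E_L(L̄)`
(`localPointsEquivGeomPoints`), restricted to `n`-torsion (a homomorphism preserves `n`-torsion).
[cite: SerreGaloisCohomology1997, I.§2.4 and II.§1.1] -/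
def torsionBaseChangeMap : geomTorsion W n →+ geomTorsion (W.baseChange L) n :=
  ((((localPointsEquivGeomPoints W L : localPoints W L ≃+ geomPoints (W.baseChange L)) :
      localPoints W L →+ geomPoints (W.baseChange L)).comp
        ((pointsMap W L).comp (geomTorsion W n).subtype)).codRestrict
    (geomTorsion (W.baseChange L) n)) fun P ↦ by
      simp only [AddMonoidHom.coe_comp, AddSubgroup.coe_subtype, Function.comp_apply,
        AddMonoidHom.coe_coe]
      rw [mem_geomTorsion_iff, ← map_zsmul, ← map_zsmul, (mem_geomTorsion_iff W n _).mp P.2,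
        map_zero, map_zero]

/-- Values of `torsionBaseChangeMap` (the points map along the chosen embedding followed by the
identification of coefficients). [cite: SerreGaloisCohomology1997, II.§1.1] -/
@[simp]
theorem coe_torsionBaseChangeMap (P : geomTorsion W n) :
    (torsionBaseChangeMap W L n P : geomPoints (W.baseChange L)) =
      localPointsEquivGeomPoints W L (pointsMap W L P) :=
  rfl

/-- `torsionBaseChangeMap` is equivariant along `resGal L : Γ_L → Γ_K` (a compatible pair in the
sense of Serre). [cite: SerreGaloisCohomology1997, I.§2.4 (compatible pairs)] -/
theorem torsionBaseChangeMap_smul (σ : Field.absoluteGaloisGroup L) (P : geomTorsion W n) :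
    torsionBaseChangeMap W L n (resGal (K := K) L σ • P) = σ • torsionBaseChangeMap W L n P := by
  apply Subtype.ext
  rw [coe_torsionBaseChangeMap, AddSubgroup.torsionBy.coe_smul, AddSubgroup.torsionBy.coe_smul,
    pointsMap_smul, localPointsEquivGeomPoints_smul, coe_torsionBaseChangeMap]

/-- `torsionBaseChangeMap` is injective (an embedding of algebraic closures is injective on
points). [cite: SilvermanAEC2009, VIII.§1] -/
theorem torsionBaseChangeMap_injective : Function.Injective (torsionBaseChangeMap W L n) := by
  intro P Q h
  have h' := congrArg (fun x : geomTorsion (W.baseChange L) n ↦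
    (x : geomPoints (W.baseChange L))) h
  simp only [coe_torsionBaseChangeMap, EmbeddingLike.apply_eq_iff_eq] at h'
  exact Subtype.ext (pointsMapOfEmb_injective W _ h')

/-- **Restriction `H¹(K, E[n]) → H¹(L, E_L[n])`** along the compatible pair
`(resGal L, torsionBaseChangeMap)`. Serre, *Galois Cohomology*, I.§2.4; Dokchitser–Dokchitser
2010, proof of Lemma 4.14 ("the restriction map from `H¹(K, E[pⁿ])` to `H¹(F, E[pⁿ])`").
[cite: DokchitserDokchitserAnnals2010, Lemma 4.14 (proof)] -/
def resTorsion : galH1Torsion W n →+ galH1Torsion (W.baseChange L) n :=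
  resH1Hom (resGal (K := K) L) (torsionBaseChangeMap W L n) (torsionBaseChangeMap_smul W L n)

/-- **Restriction commutes with `H¹(·, E[n]) → H¹(·, E)`**:
`(E_L[n] ↪ E_L)_* ∘ res = res ∘ (E[n] ↪ E)_*`, both being the map of the pair
`(resGal L, E[n] ↪ E(K̄) → E(L̄) = E_L(L̄))` (functoriality of `H¹` in compatible pairs).
[cite: SerreGaloisCohomology1997, I.§2.4 (compatible pairs)] -/
theorem torsionH1ToH1_resTorsion (x : galH1Torsion W n) :
    torsionH1ToH1 (W.baseChange L) n (resTorsion W L n x) =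
      resBaseChange W L (torsionH1ToH1 W n x) := by
  change resH1Hom (ContinuousMonoidHom.id _) (geomTorsion (W.baseChange L) n).subtype
      (fun _ _ ↦ rfl) (resH1Hom _ _ _ x) =
    resH1Hom _ _ _ (resH1Hom (resGal (K := K) L) (pointsMap W L) (pointsMap_smul W L)
      (resH1Hom (ContinuousMonoidHom.id _) (geomTorsion W n).subtype (fun _ _ ↦ rfl) x))
  rw [resH1Hom_resH1Hom, resH1Hom_resH1Hom, resH1Hom_resH1Hom]
  exact congrFun (congrArg DFunLike.coe (resH1Hom_congr (by ext; rfl) (by ext; rfl) _ _)) x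

variable [NumberField K] [NumberField L]

/-- **Restriction maps `Sel^(n)(E/K)` into `Sel^(n)(E_L/L)`**: the Selmer groups are the
preimages of `Ш` under `H¹(·, E[n]) → H¹(·, E)` (`selmerGroup_eq_comap_sha`), restriction
commutes with these maps (`torsionH1ToH1_resTorsion`) and maps `Ш(E/K)` into `Ш(E_L/L)`
(`resBaseChange_mem_sha`). Dokchitser–Dokchitser 2010, proof of Lemma 4.14 (the map
`Sel_{pⁿ}(E/K) → Sel_{pⁿ}(E/F)`). [cite: DokchitserDokchitserAnnals2010, Lemma 4.14 (proof)] -/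
theorem resTorsion_mem_selmerGroup {x : galH1Torsion W n} (hx : x ∈ selmerGroup W n) :
    resTorsion W L n x ∈ selmerGroup (W.baseChange L) n := by
  rw [selmerGroup_eq_comap_sha, AddSubgroup.mem_comap] at hx ⊢
  rw [torsionH1ToH1_resTorsion]
  exact resBaseChange_mem_sha W L hx

end TorsionPoints

/-! ## The subgroup model of `H¹(L, E_L[n])` for `L/K` algebraic -/

section Model

variable {K : Type u} [Field K] (L : Type u) [Field L] [Algebra K L] [Algebra.IsAlgebraic K L]
  (W : WeierstrassCurve K) (n : ℤ)

/-- For `L/K` algebraic, `torsionBaseChangeMap : E[n](K̄) → E_L[n](L̄)` is bijective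
(`pointsMapOfEmb_bijective`: a `K`-embedding `K̄ → L̄` is then an isomorphism).
[cite: SerreGaloisCohomology1997, II.§1.1] -/
theorem torsionBaseChangeMap_bijective : Function.Bijective (torsionBaseChangeMap W L n) := by
  refine ⟨torsionBaseChangeMap_injective W L n, fun Q ↦ ?_⟩
  obtain ⟨P, hP⟩ := (pointsMapOfEmb_bijective L W (closureEmb (K := K) L)).2
    ((localPointsEquivGeomPoints W L).symm (Q : geomPoints (W.baseChange L)))
  have hPmem : P ∈ geomTorsion W n := by
    rw [mem_geomTorsion_iff]
    apply pointsMapOfEmb_injective W (closureEmb L)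
    rw [map_zsmul, map_zero, hP, ← map_zsmul, (mem_geomTorsion_iff _ n _).mp Q.2, map_zero]
  refine ⟨⟨P, hPmem⟩, Subtype.ext ?_⟩
  rw [coe_torsionBaseChangeMap]
  change localPointsEquivGeomPoints W L (pointsMapOfEmb W (closureEmb L) P) = Q
  rw [hP, AddEquiv.apply_symm_apply]

/-- The coefficient isomorphism `E[n](K̄) ≃ E_L[n](L̄)` for `L/K` algebraic.
[cite: SerreGaloisCohomology1997, II.§1.1] -/
def torsionBaseChangeEquiv : geomTorsion W n ≃+ geomTorsion (W.baseChange L) n :=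
  AddEquiv.ofBijective _ (torsionBaseChangeMap_bijective L W n)

/-- `torsionBaseChangeEquiv` is `torsionBaseChangeMap` (by definition).
[cite: SerreGaloisCohomology1997, II.§1.1] -/
@[simp]
theorem torsionBaseChangeEquiv_apply (P : geomTorsion W n) :
    torsionBaseChangeEquiv L W n P = torsionBaseChangeMap W L n P :=
  rfl

/-- Compatibility of the pair `(resGalToRange, torsionBaseChangeEquiv)`.
[cite: SerreGaloisCohomology1997, I.§2.4 (compatible pairs)] -/
theorem torsionBaseChangeEquiv_smul (σ : Field.absoluteGaloisGroup L) (P : geomTorsion W n) :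
    torsionBaseChangeEquiv L W n (resGalToRange (K := K) L σ • P) =
      σ • torsionBaseChangeEquiv L W n P :=
  torsionBaseChangeMap_smul W L n σ P

variable [PerfectField L]

/-- Compatibility of the inverse pair `(rangeToResGal, torsionBaseChangeEquiv⁻¹)`.
[cite: SerreGaloisCohomology1997, I.§2.4 (compatible pairs)] -/
theorem torsionBaseChangeEquiv_symm_smul (g : galRange (K := K) L)
    (Q : geomTorsion (W.baseChange L) n) :
    (torsionBaseChangeEquiv L W n).symm (rangeToResGal (K := K) L g • Q) =
      g • (torsionBaseChangeEquiv L W n).symm Q := by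
  apply (torsionBaseChangeEquiv L W n).injective
  rw [AddEquiv.apply_symm_apply]
  conv_rhs => rw [← resGalToRange_rangeToResGal L g]
  rw [torsionBaseChangeEquiv_smul, AddEquiv.apply_symm_apply]

/-- **The subgroup model of `H¹(L, E_L[n])`**: for `L/K` algebraic,
`H¹(Γ_L, E_L[n]) ≃ H¹(galRange L, E[n])`, the maps of the mutually inverse compatible pairs
`(rangeToResGal, torsionBaseChangeEquiv⁻¹)` and `(resGalToRange, torsionBaseChangeEquiv)` (the
finite-level twin of `modelIso`). [cite: SerreGaloisCohomology1997, I.§2.4 and II.§1.1] -/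
def modelIsoTorsion :
    galH1Torsion (W.baseChange L) n ≃+ subgroupH1 (galRange (K := K) L) (geomTorsion W n) where
  toFun := resH1Hom (rangeToResGal (K := K) L) (torsionBaseChangeEquiv L W n).symm.toAddMonoidHom
    (torsionBaseChangeEquiv_symm_smul L W n)
  invFun := resH1Hom (resGalToRange (K := K) L) (torsionBaseChangeEquiv L W n).toAddMonoidHom
    (torsionBaseChangeEquiv_smul L W n)
  left_inv x := by
    rw [resH1Hom_resH1Hom]
    have e : resH1Hom ((rangeToResGal (K := K) L).comp (resGalToRange (K := K) L))
        ((torsionBaseChangeEquiv L W n).toAddMonoidHom.comp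
          (torsionBaseChangeEquiv L W n).symm.toAddMonoidHom)
        (fun x m ↦ by
          simp only [AddMonoidHom.coe_comp, Function.comp_apply, AddEquiv.coe_toAddMonoidHom,
            ContinuousMonoidHom.comp_toFun, torsionBaseChangeEquiv_symm_smul,
            torsionBaseChangeEquiv_smul]) =
          resH1Hom (ContinuousMonoidHom.id _) (AddMonoidHom.id _) (fun _ _ ↦ rfl) :=
      resH1Hom_congr (by ext σ; exact rangeToResGal_resGalToRange L σ)
        (by ext Q; exact congrArg Subtype.val ((torsionBaseChangeEquiv L W n).apply_symm_apply Q)) _ _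
    rw [e, resH1Hom_id]
    rfl
  right_inv x := by
    rw [resH1Hom_resH1Hom]
    have e : resH1Hom ((resGalToRange (K := K) L).comp (rangeToResGal (K := K) L))
        ((torsionBaseChangeEquiv L W n).symm.toAddMonoidHom.comp
          (torsionBaseChangeEquiv L W n).toAddMonoidHom)
        (fun x m ↦ by
          simp only [AddMonoidHom.coe_comp, Function.comp_apply, AddEquiv.coe_toAddMonoidHom,
            ContinuousMonoidHom.comp_toFun, torsionBaseChangeEquiv_symm_smul,
            torsionBaseChangeEquiv_smul]) =
          resH1Hom (ContinuousMonoidHom.id _) (AddMonoidHom.id _) (fun _ _ ↦ rfl) :=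
      resH1Hom_congr (by ext g; exact congrArg Subtype.val (resGalToRange_rangeToResGal L g))
        (by ext P; exact congrArg Subtype.val ((torsionBaseChangeEquiv L W n).symm_apply_apply P)) _ _
    rw [e, resH1Hom_id]
    rfl
  map_add' := map_add _

/-- `modelIsoTorsion` as a function (the map of the pair `(rangeToResGal, torsionBaseChangeEquiv⁻¹)`).
[cite: SerreGaloisCohomology1997, I.§2.4 (compatible pairs)] -/
theorem modelIsoTorsion_apply (x : galH1Torsion (W.baseChange L) n) :
    modelIsoTorsion L W n x = resH1Hom (rangeToResGal (K := K) L)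
      (torsionBaseChangeEquiv L W n).symm.toAddMonoidHom (torsionBaseChangeEquiv_symm_smul L W n) x :=
  rfl

/-- **Under the subgroup model, `resTorsion` is the restriction to the subgroup `galRange L`**
(the pair `(galRange L ↪ Γ_K, id)`, i.e. `resSubgroupH1`).
[cite: SerreGaloisCohomology1997, I.§2.4 (restriction)] -/
theorem modelIsoTorsion_resTorsion (x : galH1Torsion W n) :
    modelIsoTorsion L W n (resTorsion W L n x) =
      resSubgroupH1 (galRange (K := K) L) (geomTorsion W n) x := by
  rw [modelIsoTorsion_apply, resTorsion, resH1Hom_resH1Hom, resSubgroupH1]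
  exact congrFun (congrArg DFunLike.coe (resH1Hom_congr
    (by ext g; exact congrArg Subtype.val (resGalToRange_rangeToResGal L g))
    (by ext P; exact congrArg Subtype.val ((torsionBaseChangeEquiv L W n).symm_apply_apply P)) _ _)) x

end Model

/-! ## Number fields: the kernel of restriction is killed by the index -/

section Index

variable {K : Type u} [Field K] [NumberField K] (L : Type u) [Field L] [NumberField L] [Algebra K L]
  (W : WeierstrassCurve K) (n : ℤ)

/-- **The kernel of `res : H¹(K, E[n]) → H¹(L, E_L[n])` is killed by the index
`(Γ_K : galRange L)`** (Serre, *Galois Cohomology*, I.§2.4, Prop. 9: `cor ∘ res = index`, the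
tree's `index_nsmul_eq_zero_of_resSubgroupH1_eq_zero`, transported through the subgroup model
`modelIsoTorsion_resTorsion`; `galRange L` is open, `isOpen_galRange`). Dokchitser–Dokchitser
2010, proof of Lemma 4.14 ("kernel … killed by `|G|`").
[cite: SerreGaloisCohomology1997, I.§2.4 Prop. 9] -/
theorem index_nsmul_eq_zero_of_resTorsion_eq_zero {x : galH1Torsion W n}
    (hx : resTorsion W L n x = 0) : (galRange (K := K) L).index • x = 0 := by
  haveI : Algebra.IsAlgebraic K L := Algebra.IsAlgebraic.of_finite K L
  haveI : (galRange (K := K) L).FiniteIndex :=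
    Subgroup.finiteIndex_of_le (galSubgroupClosure_le_galRange (K := K) L)
  haveI : Fintype (Field.absoluteGaloisGroup K ⧸ galRange (K := K) L) := Fintype.ofFinite _
  apply index_nsmul_eq_zero_of_resSubgroupH1_eq_zero (galRange (K := K) L) (isOpen_galRange L)
  rw [← modelIsoTorsion_resTorsion L W n x, hx, map_zero]

end Index

/-! ## `E/ℚ` over a quadratic field: the `Gal(K/ℚ)`-action in the subgroup model -/

section Quadratic

variable (K : Type) [Field K] [NumberField K] (W : WeierstrassCurve ℚ) (n : ℤ) (σ₀ : K ≃ₐ[ℚ] K)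

variable {K} in
/-- The coefficient sides agree on `E[n]`: `τ₀ (ι P) = ι (c₀ • P)` for the coefficient
isomorphism `ι = torsionBaseChangeEquiv`, the lift `τ₀ = liftAut σ₀` acting on `E_K[n](K̄)`
(`IsLiftOfAut.torsionMap`) and the transported lift `c₀ = liftToAbsGal K σ₀ ∈ Γ_ℚ`
(from `localPointsEquivGeomPoints_pointsMap_smul`). [cite: SerreGaloisCohomology1997, I.§2.5] -/
theorem torsionBaseChangeEquiv_smul_liftToAbsGal (P : geomTorsion W n) :
    (isLiftOfAut_liftAut σ₀).torsionMap W n (torsionBaseChangeEquiv K W n P) =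
      torsionBaseChangeEquiv K W n (liftToAbsGal (K := ℚ) K σ₀ • P) := by
  apply Subtype.ext
  rw [IsLiftOfAut.coe_torsionMap, torsionBaseChangeEquiv_apply, torsionBaseChangeEquiv_apply,
    coe_torsionBaseChangeMap, coe_torsionBaseChangeMap, AddSubgroup.torsionBy.coe_smul]
  exact (localPointsEquivGeomPoints_pointsMap_smul W σ₀ _).symm

/-- **The action in the subgroup model.** For `K` Galois quadratic with `σ₀ ≠ 1`:
`modelIsoTorsion (σ₀ · s) = (c₀)_* (modelIsoTorsion s)`, where `σ₀ · s = conjAct W σ₀ n s` is the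
action of `σ₀` on `H¹(K, E[n])` (file `SelmerGaloisAction`, through the lift `liftAut σ₀`) and
`(c₀)_* = conjH1 … (liftToAbsGal K σ₀)` is the conjugation action on `H¹(galRange K, E[n])`
(the finite-level twin of `modelIso_conjH1Primary`). [cite: SerreGaloisCohomology1997, I.§2.5] -/
theorem modelIsoTorsion_conjAct [IsGalois ℚ K] (h2 : Module.finrank ℚ K = 2) (hσ₀ : σ₀ ≠ 1)
    (s : galH1Torsion (W.baseChange K) n) :
    haveI := normal_galRange K h2 hσ₀
    modelIsoTorsion K W n (conjAct W σ₀ n s) =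
      conjH1 (galRange (K := ℚ) K) (geomTorsion W n) (liftToAbsGal (K := ℚ) K σ₀)
        (modelIsoTorsion K W n s) := by
  haveI := normal_galRange K h2 hσ₀
  have hG : ((isLiftOfAut_liftAut σ₀).conjGalCMH).comp (rangeToResGal (K := ℚ) K) =
      (rangeToResGal (K := ℚ) K).comp
        (subgroupConj (galRange (K := ℚ) K) (liftToAbsGal (K := ℚ) K σ₀)) := by
    apply ContinuousMonoidHom.ext
    intro g
    apply resGal_injective (K := ℚ) K
    change resGal (K := ℚ) K ((isLiftOfAut_liftAut σ₀).conjGalCMH (rangeToResGal (K := ℚ) K g)) =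
      resGal (K := ℚ) K (rangeToResGal (K := ℚ) K
        (subgroupConj (galRange (K := ℚ) K) (liftToAbsGal (K := ℚ) K σ₀) g))
    rw [resGal_conjGalCMH, resGal_rangeToResGal, resGal_rangeToResGal, subgroupConj_apply_coe]
  have hM : ((torsionBaseChangeEquiv K W n).symm.toAddMonoidHom).comp
        ((isLiftOfAut_liftAut σ₀).torsionMap W n) =
      (DistribSMul.toAddMonoidHom (geomTorsion W n) (liftToAbsGal (K := ℚ) K σ₀)).comp
        (torsionBaseChangeEquiv K W n).symm.toAddMonoidHom := by
    refine AddMonoidHom.ext fun m ↦ ?_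
    apply (torsionBaseChangeEquiv K W n).injective
    change torsionBaseChangeEquiv K W n ((torsionBaseChangeEquiv K W n).symm
        ((isLiftOfAut_liftAut σ₀).torsionMap W n m)) =
      torsionBaseChangeEquiv K W n (liftToAbsGal (K := ℚ) K σ₀ • (torsionBaseChangeEquiv K W n).symm m)
    rw [AddEquiv.apply_symm_apply, ← torsionBaseChangeEquiv_smul_liftToAbsGal,
      AddEquiv.apply_symm_apply]
  have hconj : conjAct W σ₀ n = resH1Hom (isLiftOfAut_liftAut σ₀).conjGalCMH
      ((isLiftOfAut_liftAut σ₀).torsionMap W n) ((isLiftOfAut_liftAut σ₀).torsionMap_smul W n) :=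
    rfl
  rw [modelIsoTorsion_apply, modelIsoTorsion_apply, hconj, conjH1, resH1Hom_resH1Hom,
    resH1Hom_resH1Hom]
  exact congrFun (congrArg DFunLike.coe (resH1Hom_congr hG hM _ _)) s

/-- **Restricted classes are fixed by `Gal(K/ℚ)`**: for `K` Galois quadratic with non-trivial
automorphism `σ₀` and every `x ∈ H¹(ℚ, E[n])`, `σ₀ · res x = res x` in `H¹(K, E[n])` (in the
subgroup model `res x` is the restriction to the normal subgroup `galRange K`, on which the
conjugation by any element of `Γ_ℚ` acts trivially: `conjH1_resSubgroupH1_eq`, Serre, *Local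
Fields*, VII.§5, Prop. 3). This is `res (H¹(ℚ, E_p)) ⊆ H¹(K, E_p)^+` of Gross 1991, §5 (5.1).
[cite: GrossLMS1991, §5 (5.1)] [cite: SerreLocalFields1979, VII.§5 Prop. 3] -/
theorem conjAct_resTorsion [IsGalois ℚ K] (h2 : Module.finrank ℚ K = 2) (hσ₀ : σ₀ ≠ 1)
    (x : galH1Torsion W n) :
    conjAct W σ₀ n (resTorsion W K n x) = resTorsion W K n x := by
  haveI := normal_galRange K h2 hσ₀
  haveI : Algebra.IsAlgebraic ℚ K := Algebra.IsAlgebraic.of_finite ℚ K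
  apply (modelIsoTorsion K W n).injective
  rw [modelIsoTorsion_conjAct K W n σ₀ h2 hσ₀, modelIsoTorsion_resTorsion,
    conjH1_resSubgroupH1_eq]

/-- **The kernel of `res : H¹(ℚ, E[n]) → H¹(K, E[n])` is killed by `2`** for `K` Galois
quadratic (`index_nsmul_eq_zero_of_resTorsion_eq_zero` with `(Γ_ℚ : galRange K) = 2`,
`index_galRange`). Dokchitser–Dokchitser 2010, proof of Lemma 4.14.
[cite: SerreGaloisCohomology1997, I.§2.4 Prop. 9] -/
theorem two_nsmul_eq_zero_of_resTorsion_eq_zero [IsGalois ℚ K] (h2 : Module.finrank ℚ K = 2)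
    (hσ₀ : σ₀ ≠ 1) {x : galH1Torsion W n} (hx : resTorsion W K n x = 0) : 2 • x = 0 := by
  rw [← index_galRange K h2 hσ₀]
  exact index_nsmul_eq_zero_of_resTorsion_eq_zero K W n hx

/-- **For an odd prime `p` and a Galois quadratic field `K`, `res : H¹(ℚ, E[p]) → H¹(K, E[p])`
is injective**: a class in the kernel is killed by `2` (`two_nsmul_eq_zero_of_resTorsion_eq_zero`)
and by `p` (`H¹(ℚ, E[p])` is `p`-torsion, `zsmul_discreteH1_torsion`), hence by
`gcd(2, p) = 1`. Gross 1991, §5 (5.1) ("since `p` is odd"); Dokchitser–Dokchitser 2010, proof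
of Lemma 4.14. [cite: GrossLMS1991, §5 (5.1)] -/
theorem resTorsion_injective_of_odd [IsGalois ℚ K] (h2 : Module.finrank ℚ K = 2) (hσ₀ : σ₀ ≠ 1)
    {p : ℕ} (hp : p.Prime) (hp2 : p ≠ 2) : Function.Injective (resTorsion W K (p : ℤ)) := by
  refine (injective_iff_map_eq_zero _).mpr fun x hx ↦ ?_
  have h2x' : ((2 : ℕ) : ℤ) • x = 0 := by
    rw [natCast_zsmul]
    exact two_nsmul_eq_zero_of_resTorsion_eq_zero K W (p : ℤ) σ₀ h2 hσ₀ hx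
  have h2x : (2 : ℤ) • x = 0 := by exact_mod_cast h2x'
  have hpx : (p : ℤ) • x = 0 := zsmul_discreteH1_torsion (p : ℤ) x
  obtain ⟨m, hm⟩ := hp.odd_of_ne_two hp2
  have key : ((p : ℤ) - (m : ℤ) * 2) = 1 := by rw [hm]; push_cast; ring
  calc x = (1 : ℤ) • x := (one_zsmul x).symm
    _ = ((p : ℤ) - (m : ℤ) * 2) • x := by rw [key]
    _ = (p : ℤ) • x - (m : ℤ) • ((2 : ℤ) • x) := by rw [sub_zsmul, mul_zsmul, sub_eq_add_neg]
    _ = 0 := by rw [hpx, h2x, zsmul_zero, sub_zero]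

variable {K} in
/-- **`res` carries `Sel_p(E/ℚ)` into the `+1`-eigenspace `Sel_p(E/K)^+`**: for
`x ∈ Sel^(n)(E/ℚ)`, `res x ∈ Sel^(n)(E_K/K)` (`resTorsion_mem_selmerGroup`) and
`σ₀ · res x = 1 • res x` (`conjAct_resTorsion`). Gross 1991, §5 (5.1), the subgroup
`Sel(E/K)_p^+`; Kolyvagin's descent reads `Sel(E/ℚ)_p` inside it. [cite: GrossLMS1991, §5 (5.1)] -/
theorem resTorsion_mem_selmerGroup_and_conjAct_eq [IsGalois ℚ K] (h2 : Module.finrank ℚ K = 2)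
    (hσ₀ : σ₀ ≠ 1) {x : galH1Torsion W n} (hx : x ∈ selmerGroup W n) :
    resTorsion W K n x ∈ selmerGroup (W.baseChange K) n ∧
      conjAct W σ₀ n (resTorsion W K n x) = (1 : ℤ) • resTorsion W K n x := by
  rw [one_zsmul]
  exact ⟨resTorsion_mem_selmerGroup W K n hx, conjAct_resTorsion K W n σ₀ h2 hσ₀ x⟩

variable {K} in
/-- **`#Sel_p(E/ℚ) ≤ #T` for any finite subgroup `T ⊆ H¹(K, E[p])` containing the `+1`-eigen
Selmer classes** (`K` Galois quadratic, `p` an odd prime): `res` is injective on `H¹(ℚ, E[p])`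
(`resTorsion_injective_of_odd`) and maps `Sel_p(E/ℚ)` into
`{s ∈ Sel_p(E/K) : σ₀ · s = 1 • s} ⊆ T` (`resTorsion_mem_selmerGroup_and_conjAct_eq`); in
particular `Sel_p(E/ℚ)` is finite as soon as `T` is. Applied by the BSD route
`KolyvaginDepthDoor` with `T = Sel_p(E/K)^+` bounded by Kolyvagin's descent
(`KolyvaginDescent.HypothesesDepth.card_eigenSel_le_of_ne_zero`). [cite: GrossLMS1991, §5 (5.1)] -/
theorem natCard_selmerGroup_le_of_forall_mem [IsGalois ℚ K] (h2 : Module.finrank ℚ K = 2)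
    (hσ₀ : σ₀ ≠ 1) {p : ℕ} (hp : p.Prime) (hp2 : p ≠ 2)
    (T : AddSubgroup (galH1Torsion (W.baseChange K) (p : ℤ))) [Finite T]
    (hT : ∀ s ∈ selmerGroup (W.baseChange K) (p : ℤ), conjAct W σ₀ (p : ℤ) s = (1 : ℤ) • s → s ∈ T) :
    Finite (selmerGroup W (p : ℤ)) ∧ Nat.card (selmerGroup W (p : ℤ)) ≤ Nat.card T := by
  let f : selmerGroup W (p : ℤ) → T := fun x ↦ ⟨resTorsion W K (p : ℤ) x,
    hT _ (resTorsion_mem_selmerGroup_and_conjAct_eq W (p : ℤ) σ₀ h2 hσ₀ x.2).1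
      (resTorsion_mem_selmerGroup_and_conjAct_eq W (p : ℤ) σ₀ h2 hσ₀ x.2).2⟩
  have hf : Function.Injective f := fun a b h ↦
    Subtype.ext (resTorsion_injective_of_odd K W σ₀ h2 hσ₀ hp hp2 (congrArg Subtype.val h))
  exact ⟨Finite.of_injective f hf, Nat.card_le_card_of_injective f hf⟩

/-- **The same for a quadratic number field given by its degree** (`[K : ℚ] = 2`; such a `K` is
Galois over `ℚ`, Mathlib `Algebra.IsQuadraticExtension`, and has a non-trivial automorphism): for an odd
prime `p` and any `σ₀ ≠ 1` in `Aut(K/ℚ)`, `#Sel_p(E/ℚ) ≤ #T` for every finite subgroup `T` of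
`H¹(K, E[p])` containing `{s ∈ Sel_p(E/K) : σ₀ · s = s}`. [cite: GrossLMS1991, §5 (5.1)] -/
theorem natCard_selmerGroup_le_of_forall_mem_of_finrank_eq_two (h2 : Module.finrank ℚ K = 2)
    (hσ₀ : σ₀ ≠ 1) {p : ℕ} (hp : p.Prime) (hp2 : p ≠ 2)
    (T : AddSubgroup (galH1Torsion (W.baseChange K) (p : ℤ))) [Finite T]
    (hT : ∀ s ∈ selmerGroup (W.baseChange K) (p : ℤ), conjAct W σ₀ (p : ℤ) s = (1 : ℤ) • s → s ∈ T) :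
    Finite (selmerGroup W (p : ℤ)) ∧ Nat.card (selmerGroup W (p : ℤ)) ≤ Nat.card T := by
  haveI : Algebra.IsQuadraticExtension ℚ K := ⟨h2⟩
  haveI : IsGalois ℚ K := inferInstance
  exact natCard_selmerGroup_le_of_forall_mem W σ₀ h2 hσ₀ hp hp2 T hT

end Quadratic

end Literature.NumberTheory.EllipticCurves
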